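import Summits.HubbardSuperconductivity.HubbardSuperconductivity.Theorems.JosephsonMirrorJmInterchangeRateForm
import Summits.HubbardSuperconductivity.HubbardSuperconductivity.Theorems.JosephsonMirrorJmInterchangeBridge
import Summits.HubbardSuperconductivity.HubbardSuperconductivity.Theorems.JosephsonMirrorJmPairBridgeFloorGap
import Summits.HubbardSuperconductivity.HubbardSuperconductivity.Theorems.JosephsonMirrorPairBridgeGivesGain
import Literature.MathematicalPhysics.QuantumLattice.FreeFermiGasNoThermalPairFieldLRO

/-!
# Route `JosephsonMirror` — crux `JmInterchange` (stmt-HubbardSuperconductivity-2227), line `Sketch` (lead c3):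
# the crux is EXACTLY a quantifier interchange in the onset of the Josephson gain

The hypothesis of the crux `JmInterchange` is linear Josephson gain of the window double with POINTWISE onset,
`∀ J ∈ (0, J₀] ∃ L₀(J) ∀ even L ≥ L₀(J): a J L² ≤ E_L(0) − E_L(J)` (thermodynamic limit first, then `J → 0⁺`).
This file proves, volume by volume and at EVERY `(U, δ)`:

* `exists_twoFloorIsolation` — in each volume the two sector floors `G(N, 0)`, `G(N − 2, 0)` of the Hubbard torus are
  isolated inside their sectors at SOME positive scale (finite dimension; `stub_floorGap`);
* `floorBridge_of_uniformGain` — UNIFORM-onset gain (`∃ L₀ ∀ J ∈ (0, J₀] ∀ even L ≥ L₀`) implies the crux's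
  conclusion (the ground-floor pair bridge `|⟨χ, Δ_d φ⟩|² ≥ (a/4) L⁴`), with NO isolation hypothesis: read the gain at
  the mesoscopic coupling `J = min J₀ (κ₀ γ_L / L²)` of each volume and apply `floorBridge_of_mesoscopicGain` (p129634);
  this is the strategist's attached candidate (`Cruxes/JmInterchange/StrategyCensus.lean`), landed;
* `uniformGain_of_floorBridge` — conversely a floor pair bridge `|⟨χ, Δ_d φ⟩|² ≥ a' L⁴` beyond `L₀` gives the gain
  `a' J L² ≤ E_L(0) − E_L(J)` for ALL `J ≥ 0` and all even `L ≥ L₀` (`jmPairBridgeGivesGain_proof`): uniform onset;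
* `jmInterchange_iff_onsetUpgrade` — hence the filed crux is EQUIVALENT to: "at every `(U, δ, a, J₀)`, pointwise-onset
  linear gain on `(0, J₀]` implies uniform-onset linear gain (for all `J ≥ 0`, with some constant `a' > 0`)".  In words:
  `JmInterchange` holds iff the onset `L₀(J)` of the linear Josephson gain can always be chosen independent of `J` —
  literally the interchange of `lim_{J↓0}` and `liminf_L` for the monotone family `(E_L(0) − E_L(J))/(J L²)` that the
  route's docstring describes, and nothing else.  Together with `jmInterchange_iff_reachesFloor_and_bridges`
  (p127245: the same statement ⟺ (R1 ∧ R2′), the Lieb–Seiringer–Yngvason/Tasaki open converse) this closes the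
  dictionary pointwise-onset cusp ⟺ zero-excess pair order, uniform-onset cusp ⟺ floor bridge.

Sources: T. Koma, H. Tasaki, J. Stat. Phys. 76 (1994) 745 (§3.4, Conjecture 10); E. H. Lieb, R. Seiringer,
J. Yngvason, Rep. Math. Phys. 59 (2007) 389 (the interchange of `λ → 0` and `Λ → ∞`, open converse p. 9);
H. Tasaki, J. Stat. Phys. 174 (2019) 735 §5.  Pure finite-dimensional bookkeeping over landed theorems; no new
definitions (statements spelled out on the tree's vocabulary).
-/

-- the mandated namespace `Summit.<Summit>.<Problem>.Theorems` repeats `HubbardSuperconductivity`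
-- (single-problem summit, D-0017), which the `dupNamespace` linter flags on every declaration
set_option linter.dupNamespace false

namespace Summit.HubbardSuperconductivity.HubbardSuperconductivity.Theorems.JosephsonMirror

open Matrix Literature.MathematicalPhysics.QuantumLattice Filter
open Summit.HubbardSuperconductivity.HubbardSuperconductivity.Theses.JosephsonMirror (JmInterchange JmPairBridgeGivesGain)

/-- **Two-floor isolation in a fixed volume.**  For every `L`, `U`, `N` there is `γ > 0` such that, for
`n ∈ {N, N − 2}`, every vector of `szSector n 0` orthogonal to the sector ground floor of `hubbardTorus 2 L 1 U` has
energy `≥ (e(n) + γ)‖w‖²` — the smaller of the two second-eigenvalue gaps of the finite-dimensional sector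
compressions (`stub_floorGap`).  No uniformity in `L` is claimed. [folklore] -/
theorem exists_twoFloorIsolation (L : ℕ) [NeZero L] (U : ℝ) (N : ℕ) :
    ∃ γ : ℝ, 0 < γ ∧ ∀ n : ℕ, (n = N ∨ n = N - 2) → ∀ w : Fock (Orb (FermionTorus 2 L)), w ∈ szSector n 0 →
      (∀ g : Fock (Orb (FermionTorus 2 L)), IsGroundStateInSector (hubbardTorus 2 L 1 U) n 0 g → star g ⬝ᵥ w = 0) →
        ((hubbardTorus 2 L 1 U).minEnergyOn (szSector n 0) + γ) * (star w ⬝ᵥ w).re ≤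
          (star w ⬝ᵥ (hubbardTorus 2 L 1 U *ᵥ w)).re := by
  classical
  set H := hubbardTorus 2 L 1 U with hHdef
  have hherm : H.IsHermitian := LiebThm1.hamiltonian_isHermitian (fermionTorusGraph 2 L) 1 U
  -- one sector at a time
  have hsec : ∀ n : ℕ, ∃ γ : ℝ, 0 < γ ∧ ∀ w : Fock (Orb (FermionTorus 2 L)), w ∈ szSector n 0 →
      (∀ g : Fock (Orb (FermionTorus 2 L)), IsGroundStateInSector H n 0 g → star g ⬝ᵥ w = 0) →
        (H.minEnergyOn (szSector n 0) + γ) * (star w ⬝ᵥ w).re ≤ (star w ⬝ᵥ (H *ᵥ w)).re := by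
    intro n
    set K : Submodule ℂ (Fock (Orb (FermionTorus 2 L))) := szSector n 0 with hKdef
    have hinv : ∀ v ∈ K, H *ᵥ v ∈ K := fun v hv => hubbardTorus_mulVec_mem_szSector 1 U hv
    have hm : ∀ v ∈ K, H.minEnergyOn K * (star v ⬝ᵥ v).re ≤ (star v ⬝ᵥ H *ᵥ v).re :=
      fun v hv => minEnergyOn_mul_le_of_mem hherm K hv
    obtain ⟨μ, hμ, hgap, -⟩ := stub_floorGap H hherm.eq K hinv (H.minEnergyOn K) hm
    refine ⟨μ - H.minEnergyOn K, sub_pos.mpr hμ, fun w hw horth => ?_⟩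
    have hw' : ∀ ψ ∈ K, H *ᵥ ψ = ((H.minEnergyOn K : ℝ) : ℂ) • ψ → star ψ ⬝ᵥ w = 0 := by
      intro ψ hψ hHψ
      by_cases h0 : ψ = 0
      · rw [h0, star_zero, zero_dotProduct]
      · exact horth ψ ⟨hψ, h0, hHψ⟩
    have := hgap w hw hw'
    rw [add_sub_cancel]
    exact this
  obtain ⟨γ₁, hγ₁, h₁⟩ := hsec N
  obtain ⟨γ₂, hγ₂, h₂⟩ := hsec (N - 2)
  refine ⟨min γ₁ γ₂, lt_min hγ₁ hγ₂, ?_⟩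
  rintro n (rfl | rfl) w hw horth
  · have h := h₁ w hw horth
    have hww : 0 ≤ (star w ⬝ᵥ w).re := EigenvalueContinuation.re_star_dotProduct_self_nonneg w
    have : (H.minEnergyOn (szSector n 0) + min γ₁ γ₂) * (star w ⬝ᵥ w).re ≤
        (H.minEnergyOn (szSector n 0) + γ₁) * (star w ⬝ᵥ w).re :=
      mul_le_mul_of_nonneg_right (by linarith [min_le_left γ₁ γ₂]) hww
    exact this.trans h
  · have h := h₂ w hw horth
    have hww : 0 ≤ (star w ⬝ᵥ w).re := EigenvalueContinuation.re_star_dotProduct_self_nonneg w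
    have : (H.minEnergyOn (szSector (N - 2) 0) + min γ₁ γ₂) * (star w ⬝ᵥ w).re ≤
        (H.minEnergyOn (szSector (N - 2) 0) + γ₂) * (star w ⬝ᵥ w).re :=
      mul_le_mul_of_nonneg_right (by linarith [min_le_right γ₁ γ₂]) hww
    exact this.trans h

/-- **Uniform-onset gain ⇒ the ground-floor pair bridge (collapse lemma).**  If at `(U, δ, a, J₀)` the window double
gains `a J L² ≤ E_L(0) − E_L(J)` for all `J ∈ (0, J₀]` and all even `L ≥ L₀` with ONE onset `L₀` (the filed
hypothesis of `JmInterchange` with `∃ L₀` moved in front of `∀ J`), then eventually in even `L` some unit ground-floor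
pair `φ ∈ G(N_L, 0)`, `χ ∈ G(N_L − 2, 0)` has `(a/4) L⁴ ≤ |⟨χ, Δ_d φ⟩|²` — the conclusion of the crux, at every
`(U, δ)`, with no isolation hypothesis: in each volume the floors are isolated at some scale `γ_L > 0`
(`exists_twoFloorIsolation`) and the gain is read at the mesoscopic coupling `J = min J₀ (κ₀ γ_L / L²)`
(`floorBridge_of_mesoscopicGain`).  Koma–Tasaki (1994) §3.4; Lieb–Seiringer–Yngvason (2007). [folklore] -/
theorem floorBridge_of_uniformGain (U δ a J₀ : ℝ) (hδ : δ ∈ Set.Ioo (0:ℝ) (1 / 2)) (ha : 0 < a) (hJ₀ : 0 < J₀)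
    (hG : ∃ L₀ : ℕ, ∀ J ∈ Set.Ioc (0:ℝ) J₀, ∀ (L : ℕ) [NeZero L], Even L → L₀ ≤ L → (let ι : Type := Finset (Literature.MathematicalPhysics.QuantumLattice.Orb (Literature.MathematicalPhysics.QuantumLattice.FermionTorus 2 L)); let N : ℕ := 2 * ⌊(1 - δ) * (L : ℝ) ^ 2 / 2⌋₊; let H : Matrix ι ι ℂ := Literature.MathematicalPhysics.QuantumLattice.hubbardTorus 2 L 1 U; let μ : ℝ := (H.minEnergyOn (Literature.MathematicalPhysics.QuantumLattice.szSector N 0) - H.minEnergyOn (Literature.MathematicalPhysics.QuantumLattice.szSector (N - 2) 0)) / 2; let A : Matrix ι ι ℂ := Literature.MathematicalPhysics.QuantumLattice.hubbardTorusWith 2 L 1 U μ; let D : Matrix ι ι ℂ := ((L : ℂ))⁻¹ • Literature.MathematicalPhysics.QuantumLattice.pairField Literature.MathematicalPhysics.QuantumLattice.dWaveFormFactor L; let Hd : ℝ → Matrix (ι × ι) (ι × ι) ℂ := fun J => Matrix.kroneckerMap (fun a b : ℂ => a * b) A 1 + Matrix.kroneckerMap (fun a b : ℂ => a * b) 1 (Matrix.transpose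 A) - (J : ℂ) • (Matrix.kroneckerMap (fun a b : ℂ => a * b) D (Matrix.transpose (Matrix.conjTranspose D)) + Matrix.kroneckerMap (fun a b : ℂ => a * b) (Matrix.conjTranspose D) (Matrix.transpose D)); let good : ι × ι → Prop := fun p => ((p.1.card = N ∧ p.2.card = N) ∨ (p.1.card = N - 2 ∧ p.2.card = N - 2)) ∧ (p.1.filter (fun o => (ofLex o).2 = 0)).card = (p.1.filter (fun o => (ofLex o).2 = 1)).card ∧ (p.2.filter (fun o => (ofLex o).2 = 0)).card = (p.2.filter (fun o => (ofLex o).2 = 1)).card; let S : Submodule ℂ (ι × ι → ℂ) := ⨅ (p : ι × ι) (_ : ¬ good p), LinearMap.ker (LinearMap.proj (R := ℂ) (φ := fun _ : ι × ι => ℂ) p); let E : ℝ → ℝ := fun J => (Hd J).minEnergyOn S; a * J * (L : ℝ) ^ 2 ≤ E 0 - E J)) :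
    ∃ a' : ℝ, 0 < a' ∧ ∃ L₀ : ℕ, ∀ (L : ℕ) [NeZero L], Even L → L₀ ≤ L → ∃ φ χ : Literature.MathematicalPhysics.QuantumLattice.Fock (Literature.MathematicalPhysics.QuantumLattice.Orb (Literature.MathematicalPhysics.QuantumLattice.FermionTorus 2 L)), Literature.MathematicalPhysics.QuantumLattice.IsGroundStateInSector (Literature.MathematicalPhysics.QuantumLattice.hubbardTorus 2 L 1 U) (2 * ⌊(1 - δ) * (L : ℝ) ^ 2 / 2⌋₊) 0 φ ∧ star φ ⬝ᵥ φ = 1 ∧ Literature.MathematicalPhysics.QuantumLattice.IsGroundStateInSector (Literature.MathematicalPhysics.QuantumLattice.hubbardTorus 2 L 1 U) (2 * ⌊(1 - δ) * (L : ℝ) ^ 2 / 2⌋₊ - 2) 0 χ ∧ star χ ⬝ᵥ χ = 1 ∧ a' * (L : ℝ) ^ 4 ≤ ‖star χ ⬝ᵥ Matrix.mulVec (Literature.MathematicalPhysics.QuantumLattice.pairField Literature.MathematicalPhysics.QuantumLattice.dWaveFormFactor L) φ‖ ^ 2 := by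
  obtain ⟨κ₀, hκ₀, hmeso⟩ := floorBridge_of_mesoscopicGain a ha
  obtain ⟨L₀, hL₀⟩ := hG
  refine ⟨a / 4, by positivity, max L₀ 4, fun L _ hE hL => ?_⟩
  have hL₀L : L₀ ≤ L := le_trans (le_max_left _ _) hL
  have hL4 : 4 ≤ L := le_trans (le_max_right _ _) hL
  obtain ⟨γ, hγ, hiso⟩ := exists_twoFloorIsolation L U (2 * ⌊(1 - δ) * (L : ℝ) ^ 2 / 2⌋₊)
  have hL0 : (0 : ℝ) < L := by
    have : (4 : ℝ) ≤ L := by exact_mod_cast hL4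
    linarith
  have hL2 : (0 : ℝ) < (L : ℝ) ^ 2 := by positivity
  -- the mesoscopic coupling of this volume
  set J : ℝ := min J₀ (κ₀ * γ / (L : ℝ) ^ 2) with hJdef
  have hJpos : 0 < J := lt_min hJ₀ (by positivity)
  have hJle : J ≤ J₀ := min_le_left _ _
  have hJγ : J * (L : ℝ) ^ 2 ≤ κ₀ * γ := by
    have : J ≤ κ₀ * γ / (L : ℝ) ^ 2 := min_le_right _ _
    rwa [le_div_iff₀ hL2] at this
  have hgain := hL₀ J ⟨hJpos, hJle⟩ L hE hL₀L
  exact hmeso L U δ J γ hE hL4 hδ hJpos hγ hJγ hiso hgain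

/-- **A floor pair bridge gives the gain with UNIFORM onset, for every `J ≥ 0`.**  If beyond `L₀` every even volume has
unit ground states `φ ∈ G(N_L, 0)`, `χ ∈ G(N_L − 2, 0)` with `a' L⁴ ≤ |⟨χ, Δ_d φ⟩|²`, then for every `J ≥ 0` and every
even `L ≥ L₀` the window double gains `a' J L² ≤ E_L(0) − E_L(J)`: the trial state `(φ ⊗ φ̄ + χ ⊗ χ̄)/√2` of
`jmPairBridgeGivesGain_proof` gives `J |⟨χ, Δ_d φ⟩|² / L² ≤ E_L(0) − E_L(J)`.  Koma–Tasaki (1994), the easy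
(LRO ⇒ SSB) direction. [folklore] -/
theorem uniformGain_of_floorBridge (U δ a' : ℝ) (hδ : δ ∈ Set.Ioo (0:ℝ) (1 / 2)) (L₀ : ℕ)
    (hB : ∀ (L : ℕ) [NeZero L], Even L → L₀ ≤ L → ∃ φ χ : Literature.MathematicalPhysics.QuantumLattice.Fock (Literature.MathematicalPhysics.QuantumLattice.Orb (Literature.MathematicalPhysics.QuantumLattice.FermionTorus 2 L)), Literature.MathematicalPhysics.QuantumLattice.IsGroundStateInSector (Literature.MathematicalPhysics.QuantumLattice.hubbardTorus 2 L 1 U) (2 * ⌊(1 - δ) * (L : ℝ) ^ 2 / 2⌋₊) 0 φ ∧ star φ ⬝ᵥ φ = 1 ∧ Literature.MathematicalPhysics.QuantumLattice.IsGroundStateInSector (Literature.MathematicalPhysics.QuantumLattice.hubbardTorus 2 L 1 U) (2 * ⌊(1 - δ) * (L : ℝ) ^ 2 / 2⌋₊ - 2) 0 χ ∧ star χ ⬝ᵥ χ = 1 ∧ a' * (L : ℝ) ^ 4 ≤ ‖star χ ⬝ᵥ Matrix.mulVec (Literature.MathematicalPhysics.QuantumLattice.pairField Literature.MathematicalPhysics.QuantumLattice.dWaveFormFactor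 L) φ‖ ^ 2) :
    ∀ J : ℝ, 0 ≤ J → ∀ (L : ℕ) [NeZero L], Even L → L₀ ≤ L → (let ι : Type := Finset (Literature.MathematicalPhysics.QuantumLattice.Orb (Literature.MathematicalPhysics.QuantumLattice.FermionTorus 2 L)); let N : ℕ := 2 * ⌊(1 - δ) * (L : ℝ) ^ 2 / 2⌋₊; let H : Matrix ι ι ℂ := Literature.MathematicalPhysics.QuantumLattice.hubbardTorus 2 L 1 U; let μ : ℝ := (H.minEnergyOn (Literature.MathematicalPhysics.QuantumLattice.szSector N 0) - H.minEnergyOn (Literature.MathematicalPhysics.QuantumLattice.szSector (N - 2) 0)) / 2; let A : Matrix ι ι ℂ := Literature.MathematicalPhysics.QuantumLattice.hubbardTorusWith 2 L 1 U μ; let D : Matrix ι ι ℂ := ((L : ℂ))⁻¹ • Literature.MathematicalPhysics.QuantumLattice.pairField Literature.MathematicalPhysics.QuantumLattice.dWaveFormFactor L; let Hd : ℝ → Matrix (ι × ι) (ι × ι) ℂ := fun J => Matrix.kroneckerMap (fun a b : ℂ => a * b) A 1 + Matrix.kroneckerMap (fun a b : ℂ => a * b) 1 (Matrix.transpose A)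 - (J : ℂ) • (Matrix.kroneckerMap (fun a b : ℂ => a * b) D (Matrix.transpose (Matrix.conjTranspose D)) + Matrix.kroneckerMap (fun a b : ℂ => a * b) (Matrix.conjTranspose D) (Matrix.transpose D)); let good : ι × ι → Prop := fun p => ((p.1.card = N ∧ p.2.card = N) ∨ (p.1.card = N - 2 ∧ p.2.card = N - 2)) ∧ (p.1.filter (fun o => (ofLex o).2 = 0)).card = (p.1.filter (fun o => (ofLex o).2 = 1)).card ∧ (p.2.filter (fun o => (ofLex o).2 = 0)).card = (p.2.filter (fun o => (ofLex o).2 = 1)).card; let S : Submodule ℂ (ι × ι → ℂ) := ⨅ (p : ι × ι) (_ : ¬ good p), LinearMap.ker (LinearMap.proj (R := ℂ) (φ := fun _ : ι × ι => ℂ) p); let E : ℝ → ℝ := fun J => (Hd J).minEnergyOn S; a' * J * (L : ℝ) ^ 2 ≤ E 0 - E J) := by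
  intro J hJ L _ hE hL
  obtain ⟨φ, χ, hφ, hφ1, hχ, hχ1, hbr⟩ := hB L hE hL
  intro ι N H μ A D Hd good S E
  -- the easy Koma–Tasaki direction on the floor pair `(φ, χ)`
  have h : J * ‖star χ ⬝ᵥ Matrix.mulVec (pairField dWaveFormFactor L) φ‖ ^ 2 / (L : ℝ) ^ 2 ≤ E 0 - E J :=
    jmPairBridgeGivesGain_proof L U δ J hE hδ hJ φ χ hφ hφ1 hχ hχ1
  have hL0 : (0 : ℝ) < L := by exact_mod_cast Nat.pos_of_ne_zero (NeZero.ne L)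
  have hL2 : (0 : ℝ) < (L : ℝ) ^ 2 := by positivity
  -- `a' L⁴ ≤ |⟨χ, Δ_d φ⟩|²` gives `a' J L² ≤ J |⟨χ, Δ_d φ⟩|² / L²`
  have h1 : a' * J * (L : ℝ) ^ 2 ≤ J * ‖star χ ⬝ᵥ Matrix.mulVec (pairField dWaveFormFactor L) φ‖ ^ 2 / (L : ℝ) ^ 2 := by
    rw [le_div_iff₀ hL2]
    have hL4 : (L : ℝ) ^ 2 * (L : ℝ) ^ 2 = (L : ℝ) ^ 4 := by ring
    calc a' * J * (L : ℝ) ^ 2 * (L : ℝ) ^ 2 = J * (a' * (L : ℝ) ^ 4) := by ring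
      _ ≤ J * ‖star χ ⬝ᵥ Matrix.mulVec (pairField dWaveFormFactor L) φ‖ ^ 2 :=
          mul_le_mul_of_nonneg_left hbr hJ
  exact h1.trans h

/-- **The crux `JmInterchange` is EXACTLY the onset upgrade "pointwise ⇒ uniform".**  `JmInterchange` holds iff, at every
`U > 0`, `δ ∈ (0, 1/2)`, `a > 0`, `J₀ > 0`: linear Josephson gain of the window double with POINTWISE onset
(`∀ J ∈ (0, J₀] ∃ L₀(J) ∀ even L ≥ L₀(J): a J L² ≤ E_L(0) − E_L(J)`, the filed hypothesis verbatim) implies linear gain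
with UNIFORM onset (`∃ a' > 0 ∃ L₀ ∀ J ≥ 0 ∀ even L ≥ L₀: a' J L² ≤ E_L(0) − E_L(J)`).  `→`: the crux gives the floor
bridge, which gives uniform-onset gain (`uniformGain_of_floorBridge`); `←`: uniform-onset gain on `(0, 1]` gives the
floor bridge (`floorBridge_of_uniformGain`).  So the crux asserts precisely that `∃ L₀` and `∀ J` may be interchanged —
the commutation of `lim_{J↓0}` with `liminf_L` for the monotone family `(E_L(0) − E_L(J))/(J L²)` — universally in
`(U, δ)`; by `jmInterchange_iff_reachesFloor_and_bridges` this is the Lieb–Seiringer–Yngvason / Tasaki open converse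
(R1 ∧ R2′).  Koma–Tasaki (1994) Conjecture 10; Lieb–Seiringer–Yngvason (2007) p. 9; Tasaki (2019) §5. [folklore] -/
theorem jmInterchange_iff_onsetUpgrade :
    JmInterchange ↔
      ∀ (U δ a J₀ : ℝ), 0 < U → δ ∈ Set.Ioo (0:ℝ) (1 / 2) → 0 < a → 0 < J₀ →
        (∀ J ∈ Set.Ioc (0:ℝ) J₀, ∃ L₀ : ℕ, ∀ (L : ℕ) [NeZero L], Even L → L₀ ≤ L → (let ι : Type := Finset (Literature.MathematicalPhysics.QuantumLattice.Orb (Literature.MathematicalPhysics.QuantumLattice.FermionTorus 2 L)); let N : ℕ := 2 * ⌊(1 - δ) * (L : ℝ) ^ 2 / 2⌋₊; let H : Matrix ι ι ℂ := Literature.MathematicalPhysics.QuantumLattice.hubbardTorus 2 L 1 U; let μ : ℝ := (H.minEnergyOn (Literature.MathematicalPhysics.QuantumLattice.szSector N 0) - H.minEnergyOn (Literature.MathematicalPhysics.QuantumLattice.szSector (N - 2) 0)) / 2; let A : Matrix ι ι ℂ := Literature.MathematicalPhysics.QuantumLattice.hubbardTorusWith 2 L 1 U μ; let D : Matrix ι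 ι ℂ := ((L : ℂ))⁻¹ • Literature.MathematicalPhysics.QuantumLattice.pairField Literature.MathematicalPhysics.QuantumLattice.dWaveFormFactor L; let Hd : ℝ → Matrix (ι × ι) (ι × ι) ℂ := fun J => Matrix.kroneckerMap (fun a b : ℂ => a * b) A 1 + Matrix.kroneckerMap (fun a b : ℂ => a * b) 1 (Matrix.transpose A) - (J : ℂ) • (Matrix.kroneckerMap (fun a b : ℂ => a * b) D (Matrix.transpose (Matrix.conjTranspose D)) + Matrix.kroneckerMap (fun a b : ℂ => a * b) (Matrix.conjTranspose D) (Matrix.transpose D)); let good : ι × ι → Prop := fun p => ((p.1.card = N ∧ p.2.card = N) ∨ (p.1.card = N - 2 ∧ p.2.card = N - 2)) ∧ (p.1.filter (fun o => (ofLex o).2 = 0)).card = (p.1.filter (fun o => (ofLex o).2 = 1)).card ∧ (p.2.filter (fun o => (ofLex o).2 = 0)).card = (p.2.filter (fun o => (ofLex o).2 = 1)).card; let S : Submodule ℂ (ι × ι → ℂ) := ⨅ (p : ι × ι) (_ : ¬ good p), LinearMap.ker (LinearMap.proj (R := ℂ) (φ := fun _ : ι × ι => ℂ) p); let E : ℝ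 → ℝ := fun J => (Hd J).minEnergyOn S; a * J * (L : ℝ) ^ 2 ≤ E 0 - E J)) →
        ∃ a' : ℝ, 0 < a' ∧ ∃ L₀ : ℕ, ∀ J : ℝ, 0 ≤ J → ∀ (L : ℕ) [NeZero L], Even L → L₀ ≤ L → (let ι : Type := Finset (Literature.MathematicalPhysics.QuantumLattice.Orb (Literature.MathematicalPhysics.QuantumLattice.FermionTorus 2 L)); let N : ℕ := 2 * ⌊(1 - δ) * (L : ℝ) ^ 2 / 2⌋₊; let H : Matrix ι ι ℂ := Literature.MathematicalPhysics.QuantumLattice.hubbardTorus 2 L 1 U; let μ : ℝ := (H.minEnergyOn (Literature.MathematicalPhysics.QuantumLattice.szSector N 0) - H.minEnergyOn (Literature.MathematicalPhysics.QuantumLattice.szSector (N - 2) 0)) / 2; let A : Matrix ι ι ℂ := Literature.MathematicalPhysics.QuantumLattice.hubbardTorusWith 2 L 1 U μ; let D : Matrix ι ι ℂ := ((L : ℂ))⁻¹ • Literature.MathematicalPhysics.QuantumLattice.pairField Literature.MathematicalPhysics.QuantumLattice.dWaveFormFactor L; let Hd : ℝ → Matrix (ι × ι) (ι × ι) ℂ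 := fun J => Matrix.kroneckerMap (fun a b : ℂ => a * b) A 1 + Matrix.kroneckerMap (fun a b : ℂ => a * b) 1 (Matrix.transpose A) - (J : ℂ) • (Matrix.kroneckerMap (fun a b : ℂ => a * b) D (Matrix.transpose (Matrix.conjTranspose D)) + Matrix.kroneckerMap (fun a b : ℂ => a * b) (Matrix.conjTranspose D) (Matrix.transpose D)); let good : ι × ι → Prop := fun p => ((p.1.card = N ∧ p.2.card = N) ∨ (p.1.card = N - 2 ∧ p.2.card = N - 2)) ∧ (p.1.filter (fun o => (ofLex o).2 = 0)).card = (p.1.filter (fun o => (ofLex o).2 = 1)).card ∧ (p.2.filter (fun o => (ofLex o).2 = 0)).card = (p.2.filter (fun o => (ofLex o).2 = 1)).card; let S : Submodule ℂ (ι × ι → ℂ) := ⨅ (p : ι × ι) (_ : ¬ good p), LinearMap.ker (LinearMap.proj (R := ℂ) (φ := fun _ : ι × ι => ℂ) p); let E : ℝ → ℝ := fun J => (Hd J).minEnergyOn S; a' * J * (L : ℝ) ^ 2 ≤ E 0 - E J) := by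
  constructor
  · intro hI U δ a J₀ hU hδ ha hJ₀ hG
    -- the crux gives the floor bridge at `(U, δ)` …
    have hB := hI U δ a J₀ hU hδ ha hJ₀ hG
    obtain ⟨a', ha', L₀, hL₀⟩ := hB
    -- … and the floor bridge gives the gain with uniform onset
    exact ⟨a', ha', L₀, uniformGain_of_floorBridge U δ a' hδ L₀ (fun L _ hE hL => hL₀ L hE hL)⟩
  · intro h
    unfold JmInterchange
    intro U δ a J₀ hU hδ ha hJ₀ hG
    obtain ⟨a', ha', L₀, hL₀⟩ := h U δ a J₀ hU hδ ha hJ₀ hG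
    -- uniform-onset gain on `(0, 1]` ⇒ the floor bridge
    exact floorBridge_of_uniformGain U δ a' 1 hδ ha' one_pos
      ⟨L₀, fun J hJ L _ hE hL => hL₀ J hJ.1.le L hE hL⟩

end Summit.HubbardSuperconductivity.HubbardSuperconductivity.Theorems.JosephsonMirror
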